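import Summits.AnomalousDissipation.AnomalousDissipation.Theorems.MomentParityCubicParityLoudDiagonalClassificationBox
import Summits.AnomalousDissipation.AnomalousDissipation.Theorems.MomentParityCubicParityLoudDiagonalClassificationLatticeAxis

/-!
# Assembly of the classification of the effective Casimir blocks over a frequency ball

Helper file for stub `stub_diagonalClassification` (S3b) of the line `farkas-split-menu` of crux
`MomentParity.CubicParityLoud`.  Let `S ⊂ ℤ³ ∖ {0}` be the punctured frequency ball of radius
`N ≥ 3` and let symmetric compressed blocks `M k` and scalars `λ k` (`k ∈ S`), even in `k`,
satisfy the symmetric and antisymmetric single-triad identities on every triad `a + b = c` of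
non-parallel frequencies in `S`.  Then `M k = α·id` on `k^⊥` and `λ k = β` for ALL `k ∈ S`.
Proof: the unit box is rigid (`unitBox_S`, `unitBox_A`); a block is PROPAGATED to `c = a + b`
from two known non-parallel legs of unequal length (`propagate_S`, `triad_A`); the six remaining
frequencies of norm `≤ 3` are reached through body diagonals; the rest of the ball is the
lattice combinatorics of `lattice_offaxis` / `lattice_all` (threshold `N ≥ 3`, sharp).
-/

namespace Summit.AnomalousDissipation.AnomalousDissipation.Theorems.MomentParityCubicParityLoud

open Matrix

set_option linter.dupNamespace false

set_option maxHeartbeats 800000 in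
/-- **Classification of the effective blocks over the punctured ball of radius `N ≥ 3`.**
Symmetric compressed even blocks `M k` and even scalars `λ k` on
`S = {k ≠ 0, |k|² ≤ N²}` satisfying the two single-triad identities on all non-parallel triads
in `S` are `α·id` on `k^⊥`, resp. constant, on all of `S`. [folklore] -/
theorem assembly :
    ∀ (N : ℕ) (S : Finset (Fin 3 → ℤ)), 3 ≤ N → (∀ k : Fin 3 → ℤ, k ∈ S ↔ k ≠ 0 ∧ k ⬝ᵥ k ≤ (N : ℤ) ^ 2) →
    ∀ (M : (Fin 3 → ℤ) → Matrix (Fin 3) (Fin 3) ℝ) (lam : (Fin 3 → ℤ) → ℝ),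
    (∀ k ∈ S, (M k).IsSymm) → (∀ k ∈ S, M k *ᵥ (fun i => (k i : ℝ)) = 0) →
    (∀ k ∈ S, M (-k) = M k) → (∀ k ∈ S, lam (-k) = lam k) →
    (∀ a ∈ S, ∀ b ∈ S, ∀ c ∈ S, a + b = c → crossProduct a b ≠ 0 →
      ∀ ua ub uc : Fin 3 → ℝ, ua ⬝ᵥ (fun i => (a i : ℝ)) = 0 → ub ⬝ᵥ (fun i => (b i : ℝ)) = 0 →
        uc ⬝ᵥ (fun i => (c i : ℝ)) = 0 →
        ((uc ⬝ᵥ fun i => (b i : ℝ)) • ub - (ub ⬝ᵥ fun i => (a i : ℝ)) • uc) ⬝ᵥ (M a *ᵥ ua) +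
        ((uc ⬝ᵥ fun i => (a i : ℝ)) • ua - (ua ⬝ᵥ fun i => (b i : ℝ)) • uc) ⬝ᵥ (M b *ᵥ ub) +
        ((ua ⬝ᵥ fun i => (b i : ℝ)) • ub + (ub ⬝ᵥ fun i => (a i : ℝ)) • ua) ⬝ᵥ (M c *ᵥ uc) = 0) →
    (∀ a ∈ S, ∀ b ∈ S, ∀ c ∈ S, a + b = c → crossProduct a b ≠ 0 →
      ∀ ua ub uc : Fin 3 → ℝ, ua ⬝ᵥ (fun i => (a i : ℝ)) = 0 → ub ⬝ᵥ (fun i => (b i : ℝ)) = 0 →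
        uc ⬝ᵥ (fun i => (c i : ℝ)) = 0 →
        lam a * (((uc ⬝ᵥ fun i => (b i : ℝ)) • ub - (ub ⬝ᵥ fun i => (a i : ℝ)) • uc) ⬝ᵥ
            crossProduct (fun i => (a i : ℝ)) ua) +
        lam b * (((uc ⬝ᵥ fun i => (a i : ℝ)) • ua - (ua ⬝ᵥ fun i => (b i : ℝ)) • uc) ⬝ᵥ
            crossProduct (fun i => (b i : ℝ)) ub) -
        lam c * (((ua ⬝ᵥ fun i => (b i : ℝ)) • ub + (ub ⬝ᵥ fun i => (a i : ℝ)) • ua) ⬝ᵥ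
            crossProduct (fun i => (c i : ℝ)) uc) = 0) →
    ∃ α β : ℝ, ∀ k ∈ S,
      (∀ u w : Fin 3 → ℝ, w ⬝ᵥ (fun i => (k i : ℝ)) = 0 → u ⬝ᵥ (M k *ᵥ w) = α * (u ⬝ᵥ w)) ∧ lam k = β := by
  intro N S hN hmem M lam hsymm hker hMeven hLeven hS hA
  have hN2 : (9 : ℤ) ≤ (N : ℤ) ^ 2 := by
    have : (3 : ℤ) ≤ (N : ℤ) := by exact_mod_cast hN
    nlinarith
  -- membership of explicit short vectors
  have memS : ∀ k : Fin 3 → ℤ, k ≠ 0 → k ⬝ᵥ k ≤ 9 → k ∈ S := fun k h0 h9 =>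
    (hmem k).2 ⟨h0, h9.trans hN2⟩
  have normk : ∀ k : Fin 3 → ℤ, k ⬝ᵥ k = k 0 ^ 2 + k 1 ^ 2 + k 2 ^ 2 := fun k => by
    rw [vec3_dotProduct]; ring
  -- the unit box inside `S`
  have hUS : ∀ k ∈ ({![1, 0, 0], ![0, 1, 0], ![0, 0, 1], ![1, 1, 0], ![1, 0, 1], ![0, 1, 1], ![1, 1, 1]} : Finset (Fin 3 → ℤ)), k ∈ S := by
    intro k hk
    simp only [Finset.mem_insert, Finset.mem_singleton] at hk
    rcases hk with rfl | rfl | rfl | rfl | rfl | rfl | rfl <;> exact memS _ (by decide) (by norm_num [vec3_dotProduct])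
  obtain ⟨α, hα⟩ := unitBox_S M (fun k hk => hsymm k (hUS k hk)) (fun k hk => hker k (hUS k hk))
    (fun a ha b hb c hc => hS a (hUS a ha) b (hUS b hb) c (hUS c hc))
  obtain ⟨β, hβ⟩ := unitBox_A lam (fun a ha b hb c hc => hA a (hUS a ha) b (hUS b hb) c (hUS c hc))
  obtain ⟨G, hG⟩ : ∃ G : (Fin 3 → ℤ) → Prop, ∀ k, G k ↔
      ((∀ u w : Fin 3 → ℝ, w ⬝ᵥ (fun i => (k i : ℝ)) = 0 → u ⬝ᵥ (M k *ᵥ w) = α * (u ⬝ᵥ w)) ∧ lam k = β) :=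
    ⟨_, fun _ => Iff.rfl⟩
  suffices hmain : ∀ k ∈ S, G k from ⟨α, β, fun k hk => (hG k).1 (hmain k hk)⟩
  -- `G` on the unit box
  have GU : ∀ k ∈ ({![1, 0, 0], ![0, 1, 0], ![0, 0, 1], ![1, 1, 0], ![1, 0, 1], ![0, 1, 1], ![1, 1, 1]} : Finset (Fin 3 → ℤ)), G k :=
    fun k hk => (hG k).2 ⟨hα k hk, hβ k hk⟩
  -- evenness
  have Gneg : ∀ k ∈ S, G k → G (-k) := by
    intro k hk h
    rw [hG] at h ⊢
    refine ⟨fun u w hw => ?_, by rw [hLeven k hk]; exact h.2⟩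
    rw [hMeven k hk]
    refine h.1 u w ?_
    have e : (fun i => ((-k) i : ℝ)) = -(fun i => (k i : ℝ)) := by ext i; simp
    rwa [e, dotProduct_neg, neg_eq_zero] at hw
  -- propagation along a triad with two known legs of unequal length
  have Gprop : ∀ a ∈ S, ∀ b ∈ S, ∀ c ∈ S, a + b = c → crossProduct a b ≠ 0 → a ⬝ᵥ a ≠ b ⬝ᵥ b →
      G a → G b → G c := by
    intro a ha b hb c hc habc hab hnorm Ga Gb
    rw [hG] at Ga Gb ⊢
    have habc' : (fun i => (a i : ℝ)) + (fun i => (b i : ℝ)) = fun i => (c i : ℝ) := by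
      ext i; simp [← habc]
    have hab' : crossProduct (fun i => (a i : ℝ)) (fun i => (b i : ℝ)) ≠ 0 := by
      intro h; apply hab; ext i
      have h' := congrFun h i
      fin_cases i <;>
      · simp only [cross_apply, Fin.isValue, cons_val_zero, cons_val_one, cons_val_two, head_cons, tail_cons,
          Fin.zero_eta, Fin.mk_one, Fin.reduceFinMk, Pi.zero_apply] at h' ⊢
        exact_mod_cast h'
    have hnorm' : (fun i => (a i : ℝ)) ⬝ᵥ (fun i => (a i : ℝ)) ≠ (fun i => (b i : ℝ)) ⬝ᵥ (fun i => (b i : ℝ)) := by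
      intro h; apply hnorm
      simp only [vec3_dotProduct] at h ⊢
      exact_mod_cast h
    refine ⟨propagate_S _ _ _ (M a) (M b) (M c) α habc' hab' hnorm' (hsymm c hc) (hker c hc) Ga.1 Gb.1
      (fun ua ub uc hua hub huc => hS a ha b hb c hc habc hab ua ub uc hua hub huc), ?_⟩
    have hl := triad_A _ _ _ (lam a) (lam b) (lam c) habc' hab'
      (fun ua ub uc hua hub huc => hA a ha b hb c hc habc hab ua ub uc hua hub huc)
    rw [← hl.1]; exact Ga.2
  -- the other six frequencies of norm ≤ 3 (up to sign), through body diagonals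
  have P : ∀ a b c : Fin 3 → ℤ, a ≠ 0 → a ⬝ᵥ a ≤ 9 → b ≠ 0 → b ⬝ᵥ b ≤ 9 → c ≠ 0 → c ⬝ᵥ c ≤ 9 →
      a + b = c → crossProduct a b ≠ 0 → a ⬝ᵥ a ≠ b ⬝ᵥ b → G a → G b → G c :=
    fun a b c a0 a9 b0 b9 c0 c9 => Gprop a (memS a a0 a9) b (memS b b0 b9) c (memS c c0 c9)
  have N1 : ∀ k : Fin 3 → ℤ, k ∈ ({![1, 0, 0], ![0, 1, 0], ![0, 0, 1], ![1, 1, 0], ![1, 0, 1], ![0, 1, 1], ![1, 1, 1]} : Finset (Fin 3 → ℤ)) → G (-k) :=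
    fun k hk => Gneg k (hUS k hk) (GU k hk)
  have Gm00 : G ![-1, 0, 0] := by simpa using N1 ![1, 0, 0] (by decide)
  have G0m0 : G ![0, -1, 0] := by simpa using N1 ![0, 1, 0] (by decide)
  have G00m : G ![0, 0, -1] := by simpa using N1 ![0, 0, 1] (by decide)
  have Gm11 : G ![-1, 1, 1] := P ![0, 1, 1] ![-1, 0, 0] _ (by decide) (by norm_num [vec3_dotProduct]) (by decide)
    (by norm_num [vec3_dotProduct]) (by decide) (by norm_num [vec3_dotProduct]) (by decide) (by decide)
    (by norm_num [vec3_dotProduct]) (GU _ (by decide)) Gm00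
  have G1m1 : G ![1, -1, 1] := P ![1, 0, 1] ![0, -1, 0] _ (by decide) (by norm_num [vec3_dotProduct]) (by decide)
    (by norm_num [vec3_dotProduct]) (by decide) (by norm_num [vec3_dotProduct]) (by decide) (by decide)
    (by norm_num [vec3_dotProduct]) (GU _ (by decide)) G0m0
  have G11m : G ![1, 1, -1] := P ![1, 1, 0] ![0, 0, -1] _ (by decide) (by norm_num [vec3_dotProduct]) (by decide)
    (by norm_num [vec3_dotProduct]) (by decide) (by norm_num [vec3_dotProduct]) (by decide) (by decide)
    (by norm_num [vec3_dotProduct]) (GU _ (by decide)) G00m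
  have Gm10 : G ![-1, 1, 0] := P ![-1, 1, 1] ![0, 0, -1] _ (by decide) (by norm_num [vec3_dotProduct]) (by decide)
    (by norm_num [vec3_dotProduct]) (by decide) (by norm_num [vec3_dotProduct]) (by decide) (by decide)
    (by norm_num [vec3_dotProduct]) Gm11 G00m
  have G10m : G ![1, 0, -1] := P ![1, 1, -1] ![0, -1, 0] _ (by decide) (by norm_num [vec3_dotProduct]) (by decide)
    (by norm_num [vec3_dotProduct]) (by decide) (by norm_num [vec3_dotProduct]) (by decide) (by decide)
    (by norm_num [vec3_dotProduct]) G11m G0m0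
  have G01m : G ![0, 1, -1] := P ![1, 1, -1] ![-1, 0, 0] _ (by decide) (by norm_num [vec3_dotProduct]) (by decide)
    (by norm_num [vec3_dotProduct]) (by decide) (by norm_num [vec3_dotProduct]) (by decide) (by decide)
    (by norm_num [vec3_dotProduct]) G11m Gm00
  -- all twelve frequencies of norm 2
  have G2 : ∀ k ∈ S, k ⬝ᵥ k ≤ 2 → (k 0 ≠ 0 ∧ k 1 ≠ 0 ∨ k 0 ≠ 0 ∧ k 2 ≠ 0 ∨ k 1 ≠ 0 ∧ k 2 ≠ 0) → G k := by
    intro k hk h2 hna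
    obtain ⟨x, y, z, rfl⟩ : ∃ x y z, k = ![x, y, z] := ⟨k 0, k 1, k 2, by ext i; fin_cases i <;> rfl⟩
    rw [normk] at h2
    simp only [Fin.isValue, Matrix.cons_val_zero, Matrix.cons_val_one, Matrix.cons_val_two, Matrix.head_cons,
      Matrix.tail_cons] at hna h2
    have hx1 : -1 ≤ x := by nlinarith [sq_nonneg y, sq_nonneg z]
    have hx2 : x ≤ 1 := by nlinarith [sq_nonneg y, sq_nonneg z]
    have hy1 : -1 ≤ y := by nlinarith [sq_nonneg x, sq_nonneg z]
    have hy2 : y ≤ 1 := by nlinarith [sq_nonneg x, sq_nonneg z]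
    have hz1 : -1 ≤ z := by nlinarith [sq_nonneg x, sq_nonneg y]
    have hz2 : z ≤ 1 := by nlinarith [sq_nonneg x, sq_nonneg y]
    have mU : ∀ v ∈ ({![1, 0, 0], ![0, 1, 0], ![0, 0, 1], ![1, 1, 0], ![1, 0, 1], ![0, 1, 1], ![1, 1, 1]} : Finset (Fin 3 → ℤ)), G v := GU
    have mN : ∀ v ∈ ({![1, 0, 0], ![0, 1, 0], ![0, 0, 1], ![1, 1, 0], ![1, 0, 1], ![0, 1, 1], ![1, 1, 1]} : Finset (Fin 3 → ℤ)), G (-v) := N1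
    simp only [Finset.mem_insert, Finset.mem_singleton, forall_eq_or_imp, forall_eq] at mU mN
    obtain ⟨U1, U2, U3, U4, U5, U6, U7⟩ := mU
    obtain ⟨V1, V2, V3, V4, V5, V6, V7⟩ := mN
    have W1 := Gneg _ (memS _ (by decide) (by norm_num [vec3_dotProduct])) Gm10
    have W2 := Gneg _ (memS _ (by decide) (by norm_num [vec3_dotProduct])) G10m
    have W3 := Gneg _ (memS _ (by decide) (by norm_num [vec3_dotProduct])) G01m
    simp only [Matrix.neg_cons, Matrix.neg_empty, neg_zero] at V4 V5 V6 W1 W2 W3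
    interval_cases x <;> interval_cases y <;> interval_cases z <;>
      first
        | exact absurd hna (by decide)
        | exact absurd h2 (by decide)
        | assumption
  -- `±eᵢ`
  have GE : ∀ (i : Fin 3) (s : ℤ), (s = 1 ∨ s = -1) → G (Pi.single i s) := by
    intro i s hs
    have mU : ∀ v ∈ ({![1, 0, 0], ![0, 1, 0], ![0, 0, 1], ![1, 1, 0], ![1, 0, 1], ![0, 1, 1], ![1, 1, 1]} : Finset (Fin 3 → ℤ)), G v := GU
    simp only [Finset.mem_insert, Finset.mem_singleton, forall_eq_or_imp, forall_eq] at mU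
    obtain ⟨U1, U2, U3, -⟩ := mU
    rcases hs with rfl | rfl <;> fin_cases i
    · convert U1 using 1; decide
    · convert U2 using 1; decide
    · convert U3 using 1; decide
    · convert Gm00 using 1; decide
    · convert G0m0 using 1; decide
    · convert G00m using 1; decide
  exact lattice_all N S G hN hmem G2 GE Gprop Gneg

end Summit.AnomalousDissipation.AnomalousDissipation.Theorems.MomentParityCubicParityLoud
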